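import Summits.CriticalPhenomena.PercolationContinuityZ3.Theorems.PercNearOneGluingNoHeavyLowerTailSahiTriangleSupermodular
import Mathlib.Tactic.Linarith
import Mathlib.Tactic.Ring
import HarnessLib

/-!
# `NoHeavyLowerTail` (crux stmt-CriticalPhenomena-4575), P2 — the triangle class with an OR-TYPE (cross-submodular) member: Sahi's `C_3`

Memo SAHI-ROUTE.md §4.21 (seat `prim-masterthm-p2`, gen 7; `--supports stmt-CriticalPhenomena-4575`).  No `sorry`, no named facts,
standard axioms.  Companion of `…SahiTriangleSupermodular` (the AND-type / product member).

SETTING (class T): finite distributive lattices `α, β, γ` with FKG probability weights `wA, wB, wC`; `g : γ → β → ℝ`, `h : α → β → ℝ`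
nonnegative coordinatewise monotone (arbitrary), and the third member of NOISY-OR form
`f(c,a) = 1 − φ̂(c)·ψ̂(a)`, `φ̂ : γ → [0,1]`, `ψ̂ : α → [0,1]` antitone — i.e. `f = φ ⊕ ψ := φ + ψ − φψ` for increasing `[0,1]`-valued
`φ = 1 − φ̂`, `ψ = 1 − ψ̂`; for events on cubes: `f = 1_{U(c) ∪ V(a)}`, the OR of an increasing `c`-event and an increasing `a`-event
(the cross-SUBmodular Boolean members).  This is the configuration on which every one-coordinate / one-block heuristic of the lane is
extremal (the all-OR triple `(c∨a, c∨b, a∨b)` has all three gluing-cube faces negative, SAHI-ROUTE §4.20(a)).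

THE THEOREM (`sahiE_three_nonneg_of_orMember`): `E_3(f,g,h) ≥ 0` under the product weight on `α × β × γ`.  PROOF — an exact SIX-TERM IDENTITY on
the block `β`: with `Φ = E φ̂`, `Ψ = E ψ̂`, `m_b = E_c[(1−φ̂)g(·,b)]`, `n_b = E_c[φ̂ g(·,b)]`, `s_b = E_a[(1−ψ̂)h(·,b)]`, `t_b = E_a[ψ̂ h(·,b)]`
(nonnegative, increasing in `b`), `δ_b = Φ m_b − (1−Φ) n_b = Cov_c(1−φ̂, g_b) ≥ 0`, `ε_b = Ψ s_b − (1−Ψ) t_b = Cov_a(1−ψ̂, h_b) ≥ 0` (FKG on `γ`, `α`):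
  `E_3 = (1+ΦΨ)·Cov_b(m,s) + (1−Φ+ΦΨ)·Cov_b(m,t) + Cov_b(n,s) + (1−Φ)·E_b[n]·E_b[ε] + E_b[δ·t] + Φ·E_b[n·ε]`,
each term nonnegative (the three covariances by FKG on `β`).  [Equivalently `E_3 = (1+ΦΨ)Cov_b(G,H) − 2Cov_b(n,t) + E[δ]E[t] + E[n]E[ε]`,
`G = m+n`, `H = s+t`.]  Corollary for three Boolean cubes with product measures (`sahiE_three_nonneg_cubes_of_orMember`).
-/

noncomputable section

open scoped Classical

namespace Summit.CriticalPhenomena.PercolationContinuityZ3.Theorems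

namespace SahiTriangleSubmodular

open Finset
open Literature.Combinatorics.Sahi2008
open SahiChainTriangle (ex_prod3 drop_a drop_b drop_c)
open SahiTriangleSupermodular (fkg_sum sum3_bca sum3_acb sum3_cab)

section Main

variable {α β γ : Type} [Fintype α] [Fintype β] [Fintype γ]
  (wA : α → ℝ) (wB : β → ℝ) (wC : γ → ℝ) (φh : γ → ℝ) (ψh : α → ℝ) (g : γ → β → ℝ) (h : α → β → ℝ)

/-- `Φ = E_c φ̂`. [this work] -/
def PhiC : ℝ := ∑ c, wC c * φh c
/-- `Ψ = E_a ψ̂`. [this work] -/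
def PsiA : ℝ := ∑ a, wA a * ψh a
/-- `m_b = E_c[(1−φ̂) g(·,b)]`. [this work] -/
def mB (b : β) : ℝ := ∑ c, wC c * ((1 - φh c) * g c b)
/-- `n_b = E_c[φ̂ g(·,b)]`. [this work] -/
def nB (b : β) : ℝ := ∑ c, wC c * (φh c * g c b)
/-- `s_b = E_a[(1−ψ̂) h(·,b)]`. [this work] -/
def sB (b : β) : ℝ := ∑ a, wA a * ((1 - ψh a) * h a b)
/-- `t_b = E_a[ψ̂ h(·,b)]`. [this work] -/
def tB (b : β) : ℝ := ∑ a, wA a * (ψh a * h a b)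

variable {wA wB wC φh ψh g h}

omit [Fintype α] [Fintype β] in
/-- `0 ≤ Φ`. [this work] -/
theorem PhiC_nonneg (hC0 : ∀ c, 0 ≤ wC c) (hφ0 : ∀ c, 0 ≤ φh c) : 0 ≤ PhiC wC φh :=
  sum_nonneg fun c _ => mul_nonneg (hC0 c) (hφ0 c)

omit [Fintype α] [Fintype β] in
/-- `Φ ≤ 1` (probability weight, `φ̂ ≤ 1`). [this work] -/
theorem PhiC_le_one (hC0 : ∀ c, 0 ≤ wC c) (hC1 : ∑ c, wC c = 1) (hφ1 : ∀ c, φh c ≤ 1) : PhiC wC φh ≤ 1 := by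
  calc PhiC wC φh ≤ ∑ c, wC c * 1 := sum_le_sum fun c _ => mul_le_mul_of_nonneg_left (hφ1 c) (hC0 c)
    _ = 1 := by simp [hC1]

omit [Fintype β] [Fintype γ] in
/-- `0 ≤ Ψ`. [this work] -/
theorem PsiA_nonneg (hA0 : ∀ a, 0 ≤ wA a) (hψ0 : ∀ a, 0 ≤ ψh a) : 0 ≤ PsiA wA ψh :=
  sum_nonneg fun a _ => mul_nonneg (hA0 a) (hψ0 a)

omit [Fintype β] [Fintype γ] in
/-- `Ψ ≤ 1`. [this work] -/
theorem PsiA_le_one (hA0 : ∀ a, 0 ≤ wA a) (hA1 : ∑ a, wA a = 1) (hψ1 : ∀ a, ψh a ≤ 1) : PsiA wA ψh ≤ 1 := by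
  calc PsiA wA ψh ≤ ∑ a, wA a * 1 := sum_le_sum fun a _ => mul_le_mul_of_nonneg_left (hψ1 a) (hA0 a)
    _ = 1 := by simp [hA1]

omit [Fintype α] [Fintype β] in
/-- `m_b ≥ 0`. [this work] -/
theorem mB_nonneg (hC0 : ∀ c, 0 ≤ wC c) (hφ1 : ∀ c, φh c ≤ 1) (hg0 : ∀ c b, 0 ≤ g c b) (b : β) : 0 ≤ mB wC φh g b :=
  sum_nonneg fun c _ => mul_nonneg (hC0 c) (mul_nonneg (sub_nonneg.mpr (hφ1 c)) (hg0 c b))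

omit [Fintype α] [Fintype β] in
/-- `m` is monotone in `b`. [this work] -/
theorem mB_mono [Preorder β] (hC0 : ∀ c, 0 ≤ wC c) (hφ1 : ∀ c, φh c ≤ 1) (hgb : ∀ c, Monotone (g c)) :
    Monotone (mB wC φh g) := fun _ _ hbb =>
  sum_le_sum fun c _ => mul_le_mul_of_nonneg_left (mul_le_mul_of_nonneg_left (hgb c hbb) (sub_nonneg.mpr (hφ1 c))) (hC0 c)

omit [Fintype α] [Fintype β] in
/-- `n_b ≥ 0`. [this work] -/
theorem nB_nonneg (hC0 : ∀ c, 0 ≤ wC c) (hφ0 : ∀ c, 0 ≤ φh c) (hg0 : ∀ c b, 0 ≤ g c b) (b : β) : 0 ≤ nB wC φh g b :=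
  sum_nonneg fun c _ => mul_nonneg (hC0 c) (mul_nonneg (hφ0 c) (hg0 c b))

omit [Fintype α] [Fintype β] in
/-- `n` is monotone in `b`. [this work] -/
theorem nB_mono [Preorder β] (hC0 : ∀ c, 0 ≤ wC c) (hφ0 : ∀ c, 0 ≤ φh c) (hgb : ∀ c, Monotone (g c)) :
    Monotone (nB wC φh g) := fun _ _ hbb =>
  sum_le_sum fun c _ => mul_le_mul_of_nonneg_left (mul_le_mul_of_nonneg_left (hgb c hbb) (hφ0 c)) (hC0 c)

omit [Fintype β] [Fintype γ] in
/-- `s_b ≥ 0`. [this work] -/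
theorem sB_nonneg (hA0 : ∀ a, 0 ≤ wA a) (hψ1 : ∀ a, ψh a ≤ 1) (hh0 : ∀ a b, 0 ≤ h a b) (b : β) : 0 ≤ sB wA ψh h b :=
  sum_nonneg fun a _ => mul_nonneg (hA0 a) (mul_nonneg (sub_nonneg.mpr (hψ1 a)) (hh0 a b))

omit [Fintype β] [Fintype γ] in
/-- `s` is monotone in `b`. [this work] -/
theorem sB_mono [Preorder β] (hA0 : ∀ a, 0 ≤ wA a) (hψ1 : ∀ a, ψh a ≤ 1) (hhb : ∀ a, Monotone (h a)) :
    Monotone (sB wA ψh h) := fun _ _ hbb =>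
  sum_le_sum fun a _ => mul_le_mul_of_nonneg_left (mul_le_mul_of_nonneg_left (hhb a hbb) (sub_nonneg.mpr (hψ1 a))) (hA0 a)

omit [Fintype β] [Fintype γ] in
/-- `t_b ≥ 0`. [this work] -/
theorem tB_nonneg (hA0 : ∀ a, 0 ≤ wA a) (hψ0 : ∀ a, 0 ≤ ψh a) (hh0 : ∀ a b, 0 ≤ h a b) (b : β) : 0 ≤ tB wA ψh h b :=
  sum_nonneg fun a _ => mul_nonneg (hA0 a) (mul_nonneg (hψ0 a) (hh0 a b))

omit [Fintype β] [Fintype γ] in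
/-- `t` is monotone in `b`. [this work] -/
theorem tB_mono [Preorder β] (hA0 : ∀ a, 0 ≤ wA a) (hψ0 : ∀ a, 0 ≤ ψh a) (hhb : ∀ a, Monotone (h a)) :
    Monotone (tB wA ψh h) := fun _ _ hbb =>
  sum_le_sum fun a _ => mul_le_mul_of_nonneg_left (mul_le_mul_of_nonneg_left (hhb a hbb) (hψ0 a)) (hA0 a)

omit [Fintype α] [Fintype β] in
/-- **`δ_b = Φ m_b − (1−Φ) n_b = Cov_c(1−φ̂, g(·,b)) ≥ 0`** (FKG on `γ`: `1−φ̂` and `g(·,b)` are nonnegative monotone). [this work] -/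
theorem delta_nonneg [DistribLattice γ] (hC : IsFKGMeasure wC) (hφ1 : ∀ c, φh c ≤ 1) (hφm : Antitone φh)
    (hg0 : ∀ c b, 0 ≤ g c b) (hgc : ∀ b, Monotone (fun c => g c b)) (b : β) :
    0 ≤ PhiC wC φh * mB wC φh g b - (1 - PhiC wC φh) * nB wC φh g b := by
  have key := fkg_sum hC (u := fun c => 1 - φh c) (v := fun c => g c b)
    (fun c => sub_nonneg.mpr (hφ1 c)) (fun c => hg0 c b) (fun c c' hcc => sub_le_sub_left (hφm hcc) 1) (hgc b)
  have e1 : (∑ c, wC c * (1 - φh c)) = 1 - PhiC wC φh := by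
    simp only [mul_sub, sum_sub_distrib, mul_one, hC.sum_eq_one, PhiC]
  have e2 : (∑ c, wC c * g c b) = mB wC φh g b + nB wC φh g b := by
    simp only [mB, nB, ← sum_add_distrib]; exact sum_congr rfl fun c _ => by ring
  have e3 : (∑ c, wC c * ((1 - φh c) * g c b)) = mB wC φh g b := rfl
  rw [e1, e2, e3] at key
  nlinarith [key]

omit [Fintype β] [Fintype γ] in
/-- **`ε_b = Ψ s_b − (1−Ψ) t_b = Cov_a(1−ψ̂, h(·,b)) ≥ 0`** (FKG on `α`). [this work] -/
theorem eps_nonneg [DistribLattice α] (hA : IsFKGMeasure wA) (hψ1 : ∀ a, ψh a ≤ 1) (hψm : Antitone ψh)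
    (hh0 : ∀ a b, 0 ≤ h a b) (hha : ∀ b, Monotone (fun a => h a b)) (b : β) :
    0 ≤ PsiA wA ψh * sB wA ψh h b - (1 - PsiA wA ψh) * tB wA ψh h b := by
  have key := fkg_sum hA (u := fun a => 1 - ψh a) (v := fun a => h a b)
    (fun a => sub_nonneg.mpr (hψ1 a)) (fun a => hh0 a b) (fun a a' haa => sub_le_sub_left (hψm haa) 1) (hha b)
  have e1 : (∑ a, wA a * (1 - ψh a)) = 1 - PsiA wA ψh := by
    simp only [mul_sub, sum_sub_distrib, mul_one, hA.sum_eq_one, PsiA]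
  have e2 : (∑ a, wA a * h a b) = sB wA ψh h b + tB wA ψh h b := by
    simp only [sB, tB, ← sum_add_distrib]; exact sum_congr rfl fun a _ => by ring
  have e3 : (∑ a, wA a * ((1 - ψh a) * h a b)) = sB wA ψh h b := rfl
  rw [e1, e2, e3] at key
  nlinarith [key]

variable (wA wB wC φh ψh g h)

/-- **THEOREM (triangle with an OR-type member).**  `α, β, γ` finite distributive lattices with FKG probability weights; `g : γ → β → ℝ`,
`h : α → β → ℝ` nonnegative coordinatewise monotone; `φ̂ : γ → [0,1]`, `ψ̂ : α → [0,1]` antitone.  Then Sahi's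
`E_3(1 − φ̂⊗ψ̂, g, h) ≥ 0` under the product weight on `α × β × γ` — the member `f(c,a) = 1 − φ̂(c)ψ̂(a)` is the noisy OR of the increasing
`1−φ̂` and `1−ψ̂` (for events: the union of an increasing `c`-event and an increasing `a`-event).  Proof: the six-term identity of the
module docstring. [this work] -/
theorem sahiE_three_nonneg_of_orMember [DistribLattice α] [DistribLattice β] [DistribLattice γ]
    (hA : IsFKGMeasure wA) (hB : IsFKGMeasure wB) (hC : IsFKGMeasure wC)
    (hφ0 : ∀ c, 0 ≤ φh c) (hφ1 : ∀ c, φh c ≤ 1) (hφm : Antitone φh)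
    (hψ0 : ∀ a, 0 ≤ ψh a) (hψ1 : ∀ a, ψh a ≤ 1) (hψm : Antitone ψh)
    (hg0 : ∀ c b, 0 ≤ g c b) (hgb : ∀ c, Monotone (g c)) (hgc : ∀ b, Monotone (fun c => g c b))
    (hh0 : ∀ a b, 0 ≤ h a b) (hha : ∀ b, Monotone (fun a => h a b)) (hhb : ∀ a, Monotone (h a)) :
    0 ≤ sahiE (fun p : α × β × γ => wA p.1 * wB p.2.1 * wC p.2.2) 3
        ![fun p => 1 - φh p.2.2 * ψh p.1, fun p => g p.2.2 p.2.1, fun p => h p.1 p.2.1] := by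
  rw [sahiE_three]
  simp only [ex_prod3, Pi.mul_apply]
  -- atoms on β
  set Sms := ∑ b, wB b * (mB wC φh g b * sB wA ψh h b) with hSms
  set Smt := ∑ b, wB b * (mB wC φh g b * tB wA ψh h b) with hSmt
  set Sns := ∑ b, wB b * (nB wC φh g b * sB wA ψh h b) with hSns
  set Snt := ∑ b, wB b * (nB wC φh g b * tB wA ψh h b) with hSnt
  set Sm := ∑ b, wB b * mB wC φh g b with hSm
  set Sn := ∑ b, wB b * nB wC φh g b with hSn
  set Ss := ∑ b, wB b * sB wA ψh h b with hSs
  set St := ∑ b, wB b * tB wA ψh h b with hSt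
  set P := PhiC wC φh with hP
  set Q := PsiA wA ψh with hQ
  -- pointwise splittings
  have gsplit : ∀ b, (∑ c, wC c * g c b) = mB wC φh g b + nB wC φh g b := fun b => by
    simp only [mB, nB, ← sum_add_distrib]; exact sum_congr rfl fun c _ => by ring
  have hsplit : ∀ b, (∑ a, wA a * h a b) = sB wA ψh h b + tB wA ψh h b := fun b => by
    simp only [sB, tB, ← sum_add_distrib]; exact sum_congr rfl fun a _ => by ring
  have gφ : ∀ b, (∑ c, wC c * (φh c * g c b)) = nB wC φh g b := fun b => rfl
  have hψ : ∀ b, (∑ a, wA a * (ψh a * h a b)) = tB wA ψh h b := fun b => rfl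
  -- the seven expectations
  have eF : (∑ a, ∑ b, ∑ c, wA a * wB b * wC c * (1 - φh c * ψh a)) = 1 - P * Q := by
    have e1 : (∑ a, ∑ b, ∑ c, wA a * wB b * wC c * (1 - φh c * ψh a)) =
        (∑ a, ∑ b, ∑ c, wA a * wB b * wC c * (1 : ℝ)) - ∑ a, ∑ b, ∑ c, wA a * wB b * wC c * (φh c * ψh a) := by
      simp only [mul_sub, sum_sub_distrib]
    have e2 : (∑ a, ∑ b, ∑ c, wA a * wB b * wC c * (1 : ℝ)) = 1 := by
      have := drop_c wA wB wC hC.sum_eq_one fun _ _ => (1 : ℝ)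
      rw [this]
      simp only [mul_one, ← mul_sum, hB.sum_eq_one, hA.sum_eq_one]
    have e3 : (∑ a, ∑ b, ∑ c, wA a * wB b * wC c * (φh c * ψh a)) = P * Q := by
      rw [drop_b wA wB wC hB.sum_eq_one fun a c => φh c * ψh a, hP, hQ, PhiC, PsiA, sum_mul_sum, sum_comm]
      exact sum_congr rfl fun a _ => sum_congr rfl fun c _ => by ring
    rw [e1, e2, e3]
  have eG : (∑ a, ∑ b, ∑ c, wA a * wB b * wC c * g c b) = Sm + Sn := by
    rw [drop_a wA wB wC hA.sum_eq_one fun b c => g c b, hSm, hSn, ← sum_add_distrib]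
    refine sum_congr rfl fun b _ => ?_
    rw [← mul_add, ← gsplit b, mul_sum]
    exact sum_congr rfl fun c _ => by ring
  have eH : (∑ a, ∑ b, ∑ c, wA a * wB b * wC c * h a b) = Ss + St := by
    rw [drop_c wA wB wC hC.sum_eq_one h, sum_comm, hSs, hSt, ← sum_add_distrib]
    refine sum_congr rfl fun b _ => ?_
    rw [← mul_add, ← hsplit b, mul_sum]
    exact sum_congr rfl fun a _ => by ring
  have eGH : (∑ a, ∑ b, ∑ c, wA a * wB b * wC c * (g c b * h a b)) = Sms + Smt + Sns + Snt := by
    rw [sum3_bca]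
    have : ∀ b, (∑ c, ∑ a, wA a * wB b * wC c * (g c b * h a b)) =
        wB b * ((∑ c, wC c * g c b) * ∑ a, wA a * h a b) := fun b => by
      rw [sum_mul_sum, mul_sum]
      refine sum_congr rfl fun c _ => ?_
      rw [mul_sum]
      exact sum_congr rfl fun a _ => by ring
    simp only [this, gsplit, hsplit, hSms, hSmt, hSns, hSnt, ← sum_add_distrib]
    exact sum_congr rfl fun b _ => by ring
  have eFGH : (∑ a, ∑ b, ∑ c, wA a * wB b * wC c * ((1 - φh c * ψh a) * g c b * h a b)) = Sms + Smt + Sns := by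
    rw [sum3_bca]
    have : ∀ b, (∑ c, ∑ a, wA a * wB b * wC c * ((1 - φh c * ψh a) * g c b * h a b)) =
        wB b * ((∑ c, wC c * g c b) * (∑ a, wA a * h a b) - (∑ c, wC c * (φh c * g c b)) * ∑ a, wA a * (ψh a * h a b)) := fun b => by
      rw [sum_mul_sum, sum_mul_sum, ← sum_sub_distrib, mul_sum]
      refine sum_congr rfl fun c _ => ?_
      rw [← sum_sub_distrib, mul_sum]
      exact sum_congr rfl fun a _ => by ring
    simp only [this, gsplit, hsplit, gφ, hψ, hSms, hSmt, hSns, ← sum_add_distrib]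
    exact sum_congr rfl fun b _ => by ring
  have eFH : (∑ a, ∑ b, ∑ c, wA a * wB b * wC c * ((1 - φh c * ψh a) * h a b)) = Ss + St - P * St := by
    rw [sum3_bca]
    have : ∀ b, (∑ c, ∑ a, wA a * wB b * wC c * ((1 - φh c * ψh a) * h a b)) =
        wB b * ((∑ c, wC c * (1 : ℝ)) * (∑ a, wA a * h a b) - (∑ c, wC c * φh c) * ∑ a, wA a * (ψh a * h a b)) := fun b => by
      rw [sum_mul_sum, sum_mul_sum, ← sum_sub_distrib, mul_sum]
      refine sum_congr rfl fun c _ => ?_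
      rw [← sum_sub_distrib, mul_sum]
      exact sum_congr rfl fun a _ => by ring
    have h1 : (∑ c, wC c * (1 : ℝ)) = 1 := by simp [hC.sum_eq_one]
    simp only [this, h1, hsplit, hψ, one_mul]
    rw [hSs, hSt, hP, PhiC, mul_sum, ← sum_add_distrib, ← sum_sub_distrib]
    exact sum_congr rfl fun b _ => by ring
  have eFG : (∑ a, ∑ b, ∑ c, wA a * wB b * wC c * ((1 - φh c * ψh a) * g c b)) = Sm + Sn - Q * Sn := by
    rw [sum3_bca]
    have : ∀ b, (∑ c, ∑ a, wA a * wB b * wC c * ((1 - φh c * ψh a) * g c b)) =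
        wB b * ((∑ c, wC c * g c b) * (∑ a, wA a * (1 : ℝ)) - (∑ c, wC c * (φh c * g c b)) * ∑ a, wA a * ψh a) := fun b => by
      rw [sum_mul_sum, sum_mul_sum, ← sum_sub_distrib, mul_sum]
      refine sum_congr rfl fun c _ => ?_
      rw [← sum_sub_distrib, mul_sum]
      exact sum_congr rfl fun a _ => by ring
    have h1 : (∑ a, wA a * (1 : ℝ)) = 1 := by simp [hA.sum_eq_one]
    simp only [this, h1, gsplit, gφ]
    rw [hSm, hSn, hQ, PsiA, mul_sum, ← sum_add_distrib, ← sum_sub_distrib]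
    exact sum_congr rfl fun b _ => by ring
  rw [eF, eG, eH, eGH, eFGH, eFH, eFG]
  -- the six nonnegative terms
  have hB0 := hB.nonneg
  have mono_m := mB_mono (β := β) hC.nonneg hφ1 hgb
  have mono_n := nB_mono (β := β) hC.nonneg hφ0 hgb
  have mono_s := sB_mono (β := β) hA.nonneg hψ1 hhb
  have mono_t := tB_mono (β := β) hA.nonneg hψ0 hhb
  have m0 := mB_nonneg (β := β) hC.nonneg hφ1 hg0
  have n0 := nB_nonneg (β := β) hC.nonneg hφ0 hg0
  have s0 := sB_nonneg (β := β) hA.nonneg hψ1 hh0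
  have t0 := tB_nonneg (β := β) hA.nonneg hψ0 hh0
  have T1 : Sm * Ss ≤ Sms := fkg_sum hB m0 s0 mono_m mono_s
  have T2 : Sm * St ≤ Smt := fkg_sum hB m0 t0 mono_m mono_t
  have T3 : Sn * Ss ≤ Sns := fkg_sum hB n0 s0 mono_n mono_s
  have hP0 : 0 ≤ P := PhiC_nonneg hC.nonneg hφ0
  have hP1 : P ≤ 1 := PhiC_le_one hC.nonneg hC.sum_eq_one hφ1
  have hQ0 : 0 ≤ Q := PsiA_nonneg hA.nonneg hψ0
  have hQ1 : Q ≤ 1 := PsiA_le_one hA.nonneg hA.sum_eq_one hψ1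
  have hSn0 : 0 ≤ Sn := sum_nonneg fun b _ => mul_nonneg (hB0 b) (n0 b)
  -- E_b[ε] ≥ 0, E_b[δ t] ≥ 0, E_b[n ε] ≥ 0 in atom form
  have T4 : 0 ≤ Q * Ss - (1 - Q) * St := by
    have : Q * Ss - (1 - Q) * St = ∑ b, wB b * (Q * sB wA ψh h b - (1 - Q) * tB wA ψh h b) := by
      rw [hSs, hSt, mul_sum, mul_sum, ← sum_sub_distrib]; exact sum_congr rfl fun b _ => by ring
    rw [this]; exact sum_nonneg fun b _ => mul_nonneg (hB0 b) (eps_nonneg hA hψ1 hψm hh0 hha b)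
  have T5 : 0 ≤ P * Smt - (1 - P) * Snt := by
    have : P * Smt - (1 - P) * Snt =
        ∑ b, wB b * ((P * mB wC φh g b - (1 - P) * nB wC φh g b) * tB wA ψh h b) := by
      rw [hSmt, hSnt, mul_sum, mul_sum, ← sum_sub_distrib]; exact sum_congr rfl fun b _ => by ring
    rw [this]
    exact sum_nonneg fun b _ => mul_nonneg (hB0 b) (mul_nonneg (delta_nonneg hC hφ1 hφm hg0 hgc b) (t0 b))
  have T6 : 0 ≤ Q * Sns - (1 - Q) * Snt := by
    have : Q * Sns - (1 - Q) * Snt =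
        ∑ b, wB b * (nB wC φh g b * (Q * sB wA ψh h b - (1 - Q) * tB wA ψh h b)) := by
      rw [hSns, hSnt, mul_sum, mul_sum, ← sum_sub_distrib]; exact sum_congr rfl fun b _ => by ring
    rw [this]
    exact sum_nonneg fun b _ => mul_nonneg (hB0 b) (mul_nonneg (n0 b) (eps_nonneg hA hψ1 hψm hh0 hha b))
  -- the six-term identity, then positivity
  have ident : 2 * (Sms + Smt + Sns) + (1 - P * Q) * (Sm + Sn) * (Ss + St)
      - ((1 - P * Q) * (Sms + Smt + Sns + Snt) + (Sm + Sn) * (Ss + St - P * St) + (Ss + St) * (Sm + Sn - Q * Sn))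
      = (1 + P * Q) * (Sms - Sm * Ss) + (1 - P + P * Q) * (Smt - Sm * St) + (Sns - Sn * Ss)
        + (1 - P) * Sn * (Q * Ss - (1 - Q) * St) + (P * Smt - (1 - P) * Snt) + P * (Q * Sns - (1 - Q) * Snt) := by
    ring
  rw [ident]
  have c1 : 0 ≤ 1 + P * Q := by nlinarith
  have c2 : 0 ≤ 1 - P + P * Q := by nlinarith
  have c3 : 0 ≤ 1 - P := by linarith
  have u1 := mul_nonneg c1 (sub_nonneg.mpr T1)
  have u2 := mul_nonneg c2 (sub_nonneg.mpr T2)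
  have u3 := sub_nonneg.mpr T3
  have u4 := mul_nonneg (mul_nonneg c3 hSn0) T4
  have u6 := mul_nonneg hP0 T6
  linarith

end Main

section Cubes

variable {A B C : Type} [Fintype A] [Fintype B] [Fintype C]

/-- **Three Boolean cubes with product (Bernoulli) measures, OR-type member.**  `g : 2^C × 2^B → ℝ`, `h : 2^A × 2^B → ℝ` nonnegative
coordinatewise monotone, `φ̂ : 2^C → [0,1]`, `ψ̂ : 2^A → [0,1]` antitone ⇒ `E_3(1 − φ̂⊗ψ̂, g, h) ≥ 0` under `μ_{p_A} ⊗ μ_{p_B} ⊗ μ_{p_C}`. [this work] -/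
theorem sahiE_three_nonneg_cubes_of_orMember (pA : A → unitInterval) (pB : B → unitInterval) (pC : C → unitInterval)
    (φh : Set C → ℝ) (ψh : Set A → ℝ) (g : Set C → Set B → ℝ) (h : Set A → Set B → ℝ)
    (hφ0 : ∀ c, 0 ≤ φh c) (hφ1 : ∀ c, φh c ≤ 1) (hφm : Antitone φh)
    (hψ0 : ∀ a, 0 ≤ ψh a) (hψ1 : ∀ a, ψh a ≤ 1) (hψm : Antitone ψh)
    (hg0 : ∀ c b, 0 ≤ g c b) (hgb : ∀ c, Monotone (g c)) (hgc : ∀ b, Monotone (fun c => g c b))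
    (hh0 : ∀ a b, 0 ≤ h a b) (hha : ∀ b, Monotone (fun a => h a b)) (hhb : ∀ a, Monotone (h a)) :
    0 ≤ sahiE (fun p : Set A × Set B × Set C =>
        bernoulliWeight pA p.1 * bernoulliWeight pB p.2.1 * bernoulliWeight pC p.2.2) 3
        ![fun p => 1 - φh p.2.2 * ψh p.1, fun p => g p.2.2 p.2.1, fun p => h p.1 p.2.1] :=
  sahiE_three_nonneg_of_orMember (bernoulliWeight pA) (bernoulliWeight pB) (bernoulliWeight pC) φh ψh g h
    (isFKGMeasure_bernoulliWeight pA) (isFKGMeasure_bernoulliWeight pB) (isFKGMeasure_bernoulliWeight pC)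
    hφ0 hφ1 hφm hψ0 hψ1 hψm hg0 hgb hgc hh0 hha hhb

end Cubes

end SahiTriangleSubmodular

end Summit.CriticalPhenomena.PercolationContinuityZ3.Theorems
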